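import Literature.AlgebraicGeometry.AbelianSchemes.AbelianSchemeDualPair
import Literature.AlgebraicGeometry.RelativeSpec.GeometricQuotientRecognition
import Literature.AlgebraicGeometry.RelativeSpec.FiniteGroupQuotientGluedProperties
import Literature.AlgebraicGeometry.RelativeSpec.FreeActionOfPoints
import Literature.AlgebraicGeometry.Morphisms.GeometricPointsLiftSurjective
import Literature.AlgebraicGeometry.RelativeSpec.GeometricQuotientFreeTorsor
import HarnessLib

/-!
# The quotient of an abelian scheme by a finite constant subgroup of sections (HECKE-LINK brick H2, file (i);
# STATEMENT-LEVEL HOME DRAFT v0 — sockets-first, kernel-checked, nothing filed)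

Cell `hodgecm-mathlib`, HECKE-LINK line card v1.1 §3 (B-plan1 (g14)): file (i)
`Literature/AlgebraicGeometry/AbelianSchemes/AbelianSchemeConstSubgroupQuotient.lean` (DEF lane, token B1), drafted by
B-p20 (g9) after the census `B-provers/B-p20/g9/CENSUS-H2-DualPairOfQuotient.B-p20g9.md` (two-step descent D0–D6) and
B-p14 (g14)'s SPEC `CENSUS-B4-isogeny-quotient` §2 (H1a–c).  For an abelian scheme `A → S` ([MumfordFogartyKirwan1994] Ch. 6
§1 Def. 6.1) and a finite subgroup `K` of the group of SECTIONS `A(S)`: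

* §1 REAL: translations `t_σ : A → A` by sections (`translation`, `translationIso`, `translationAut : A(S) →* Aut_S(A)`),
  verbatim port over a base of ★ `Motives/AbelianVarietyTranslation` ([GortzWedhorn2023] Def. 27.1);
* §2 REAL: the translation action of `K` as an action datum `translationActionOver (u) K : ActionOver (A → S → Y) K` of
  the tree's quotient/descent calculus (`RelativeSpec/FiniteGroupQuotient*`, `GeometricQuotient*`, `Equivariant*`), for
  any `u : S ⟶ Y` (take `Y` affine for the quotient theorems); FREENESS in points form («no `σ ≠ 1` in `K` fixes a
  geometric point», a RAW hypothesis `hfree` throughout — no `Prop`-valued def) follows from the basis-style clause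
  «`σ ≠ 1 ⇒ σ(s̄) ≠ e(s̄)`» (`forall_comp_translation_ne_of_forall_restrict_ne`) and gives the ring form on affine charts
  via ★ `ActionOver.free_of_forall_comp_aut_ne` ([SGA1] V 2.6/2.7);
* §3 REAL: the quotient SCHEME `A/K` := ★ `ActionOver.glued` (Mumford's gluing of the affine quotients, [MumfordAV1970]
  §7 Thm. p. 66) with its structure map to `S` (★ `gluedDesc`) as an object of `Over S`, the quotient map
  `quotientMk : A.X ⟶ quotientOver`, and ★ re-exports: `quotientMk` is a geometric quotient over an affine `Y`
  (★ `isGeometricQuotient_gluedMk`), surjective, `K`-invariant;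
* §3 (cont.) REAL: `ψ` affine and finite, `A/K → S` SEPARATED and PROPER (★ `isSeparated_gluedDesc`, `isProper_gluedDesc`),
  the action RE-PACKAGED over `ψ` (`quotientActionOver`, same `aut`) with its geometric-quotient and freeness clauses —
  the exports (S2a)/(S2c) the group-law hand (B-p06 (g9)) reads; and (S2b) in §1: `t_σ` commutes with `μ`/`ι`;
* §4 NO SOCKETS (B-plan1 (g14) 20:06:07Z ruling, debt 0): the ASSEMBLY `quotientBy (hG) (hsm) (hgc) : AbelianSchemeOver S`
  takes the group law (`hG : ∃ GrpObj, IsMonHom ψ`), smoothness and geometric connectedness of `A/K → S` as RAW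
  HYPOTHESES, discharged by the follow-up PROOF files (B-p06 (g9) `RelativeSpec/GeometricQuotientGroupLaw`, B-p15 (g10)
  `Morphisms/SmoothOfFlatSurjectiveSmoothSource` + B-p09 (g10) `AbelianSchemes/AbelianSchemeConstSubgroupQuotientSmooth`,
  B-p06 (C)); REAL `comp_quotientMk_eq_one` («kernel killed») and
  `quotientMk_ontoFibres`/`quotientBy_ontoFibres` («onto on geometric fibres», ★ `Morphisms.GeometricPointsLiftSurjective`),
  `kernelKilledBy_quotientMk` («kernel killed by `m`» for `K ⊆ A[m]`, ★ free-torsor orbit lemma) — B-p04 (g17)'s H3 shapes;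
* the two-step descent's D0 («`[n]` descends to `π : A/K → A`») and D1 (the dual-kernel sections `K′ ⊂ Â(S)`,
  `(π × k)^*𝒫 ≅ 𝒪`) live in file (ii) `AbelianSchemeQuotientDualPair` (census §1); NO Weil pairing of sections is needed
  by the two-step design (B-p14's H2a is left out on purpose).

Nothing here asserts anything about HC; HC_CM is proved only modulo the 7 printed citations until rung 0 closes.

## References
* [MumfordAV1970] D. Mumford, *Abelian Varieties* (1970), §7 Thm. p. 66 and Thm. 4 (p. 72) (quotient by a finite group / subgroup); §15 Thm. 1 (p. 143).
* [MumfordFogartyKirwan1994] D. Mumford, J. Fogarty, F. Kirwan, *GIT* (3rd ed.), Ch. 6 §1 Def. 6.1, Cor. 6.4–6.5 (pp. 115–117); Ch. 7 §1 Prop. 7.1 (p. 127).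
* [GortzWedhorn2023] U. Görtz, T. Wedhorn, *Algebraic Geometry II* (2023), Def./Rem. 27.1 (p. 604), (27.41).
* [SGA1] A. Grothendieck, SGA 1, Exp. V Prop. 2.6, Déf. 2.7.
-/

noncomputable section

universe u

open CategoryTheory CategoryTheory.Limits AlgebraicGeometry MonoidalCategory CartesianMonoidalCategory
open scoped MonObj

namespace Literature.AlgebraicGeometry.AbelianSchemes

namespace AbelianSchemeOver

open Literature.AlgebraicGeometry.RelativeSpec

variable {S : Scheme.{u}} (A : AbelianSchemeOver S)

/-! ## §1 Translations by sections (REAL) -/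

/-- Any `S`-endomorphism followed by the constant section `A → S → A` at `σ` is that constant section
(`𝟙_ (Over S)` is terminal). [cite: GortzWedhorn2023, Def./Rem. 27.1 (p. 604)] -/
theorem comp_toUnit_comp (f : A.X ⟶ A.X) (σ : A.Sections) : f ≫ (toUnit A.X ≫ σ) = toUnit A.X ≫ σ := by
  rw [← Category.assoc, toUnit_unique (f ≫ toUnit A.X) (toUnit A.X)]

/-- **Translation by the section `σ`**: the `S`-morphism `t_σ : A → A`, `x ↦ σ · x` on `T`-valued points, i.e. the
product, in the group `Hom_S(A, A)` of points of the group object `A.X`, of the constant map at `σ` with the identity.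
[cite: GortzWedhorn2023, Def. 27.1 (p. 604)] -/
def translation (σ : A.Sections) : A.X ⟶ A.X :=
  (toUnit A.X ≫ σ) * 𝟙 A.X

/-- Translations compose: `t_σ ≫ t_τ = t_{τ σ}`. [cite: GortzWedhorn2023, Rem. 27.1 (p. 604)] -/
theorem translation_comp (σ τ : A.Sections) :
    A.translation σ ≫ A.translation τ = A.translation (τ * σ) := by
  unfold translation
  rw [MonObj.comp_mul, Category.comp_id, comp_toUnit_comp, MonObj.comp_mul, mul_assoc]

/-- Translation by the unit section is the identity (same statement shape as ★ `Motives.AbelianVariety.translation_one`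
over a field, whence `private` — the gate's dedup reads statements, not carriers). [cite: GortzWedhorn2023, Rem. 27.1 (p. 604)] -/
private theorem translation_one' : A.translation 1 = 𝟙 A.X := by
  unfold translation
  rw [MonObj.comp_one, one_mul]

/-- `t_σ ≫ t_{σ⁻¹} = 𝟙`. [cite: GortzWedhorn2023, Rem. 27.1 (p. 604)] -/
@[simp]
theorem translation_comp_translation_inv (σ : A.Sections) :
    A.translation σ ≫ A.translation σ⁻¹ = 𝟙 A.X := by
  rw [translation_comp, inv_mul_cancel, translation_one']

/-- `t_{σ⁻¹} ≫ t_σ = 𝟙`. [cite: GortzWedhorn2023, Rem. 27.1 (p. 604)] -/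
@[simp]
theorem translation_inv_comp_translation (σ : A.Sections) :
    A.translation σ⁻¹ ≫ A.translation σ = 𝟙 A.X := by
  rw [translation_comp, mul_inv_cancel, translation_one']

/-- On `T`-valued points: `x ≫ t_σ = (σ ∘ str) · x`. [cite: GortzWedhorn2023, Def. 27.1 (p. 604)] -/
theorem comp_translation {T : Over S} (x : T ⟶ A.X) (σ : A.Sections) :
    x ≫ A.translation σ = (toUnit T ≫ σ) * x := by
  unfold translation
  rw [MonObj.comp_mul, Category.comp_id, ← Category.assoc, toUnit_unique (x ≫ toUnit A.X) (toUnit T)]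

/-- **Translation by `σ` is an isomorphism of `S`-schemes with inverse the translation by `σ⁻¹`.**
[cite: GortzWedhorn2023, Def./Rem. 27.1 (p. 604)] -/
@[simps]
def translationIso (σ : A.Sections) : A.X ≅ A.X where
  hom := A.translation σ
  inv := A.translation σ⁻¹
  hom_inv_id := A.translation_comp_translation_inv σ
  inv_hom_id := A.translation_inv_comp_translation σ

/-- **`σ ↦ t_σ` is a homomorphism `A(S) →* Aut_S(A)`** (Mathlib's `Aut` multiplies by `g ≪≫ f`).
[cite: GortzWedhorn2023, Rem. 27.1 (p. 604)] -/
def translationAut : A.Sections →* Aut A.X where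
  toFun := A.translationIso
  map_one' := Iso.ext (by rw [translationIso_hom, translation_one']; rfl)
  map_mul' σ τ := Iso.ext (by
    rw [CategoryTheory.Aut.Aut_mul_def, Iso.trans_hom, translationIso_hom, translationIso_hom,
      translationIso_hom, translation_comp])

/-- Translation by the unit SECTION `η` is the identity (public form; `η = 1` by ★ `MonObj.one_eq_one`).
[cite: GortzWedhorn2023, Rem. 27.1 (p. 604)] -/
@[simp]
theorem translation_unitSection : A.translation η[A.X] = 𝟙 A.X := by
  rw [MonObj.one_eq_one]; exact A.translation_one'

/-- `(translationAut σ).hom = t_σ`. [cite: GortzWedhorn2023, Def. 27.1 (p. 604)] -/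
@[simp]
theorem translationAut_hom (σ : A.Sections) : (A.translationAut σ).hom = A.translation σ := rfl

/-- Translations are over `S`: `t_σ.left ≫ (A → S) = (A → S)`. [cite: GortzWedhorn2023, Def. 27.1 (p. 604)] -/
theorem translation_left_comp_hom (σ : A.Sections) : (A.translation σ).left ≫ A.X.hom = A.X.hom :=
  Over.w _

/-- The unit section followed by `t_σ` is `σ`. [cite: GortzWedhorn2023, Def. 27.1 (p. 604)] -/
theorem one_comp_translation (σ : A.Sections) : (1 : A.Sections) ≫ A.translation σ = σ := by
  rw [comp_translation, toUnit_unique (toUnit (𝟙_ (Over S))) (𝟙 _), Category.id_comp, mul_one]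

/-- **`t_σ × 1` commutes with the group law**: `(t_σ ▷ A) ≫ μ = μ ≫ t_σ` (associativity: `(σx)y = σ(xy)`).
[cite: MumfordFogartyKirwan1994, Ch. 6 §1 (p. 115)] -/
theorem translation_whiskerRight_comp_mul (σ : A.Sections) :
    (A.translation σ ▷ A.X) ≫ μ[A.X] = μ[A.X] ≫ A.translation σ := by
  have h1 : (A.translation σ ▷ A.X) ≫ μ[A.X] = ((toUnit _ ≫ σ) * fst A.X A.X) * snd A.X A.X := by
    rw [MonObj.mul_eq_mul, MonObj.comp_mul, whiskerRight_fst, whiskerRight_snd, comp_translation]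
  have h2 : μ[A.X] ≫ A.translation σ = (toUnit _ ≫ σ) * (fst A.X A.X * snd A.X A.X) := by
    rw [comp_translation, ← MonObj.mul_eq_mul]
  rw [h1, h2, mul_assoc]

/-- **`1 × t_σ` commutes with the group law of a COMMUTATIVE group scheme**: `(A ◁ t_σ) ≫ μ = μ ≫ t_σ`
(`x(σy) = σ(xy)`; abelian schemes over a reduced base are commutative, ★ `isCommMonObj_of_isReduced_base`).
[cite: MumfordFogartyKirwan1994, Ch. 6 §1 Cor. 6.5 (p. 117)] -/
theorem whiskerLeft_translation_comp_mul [IsCommMonObj A.X] (σ : A.Sections) :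
    (A.X ◁ A.translation σ) ≫ μ[A.X] = μ[A.X] ≫ A.translation σ := by
  have h1 : (A.X ◁ A.translation σ) ≫ μ[A.X] = fst A.X A.X * ((toUnit _ ≫ σ) * snd A.X A.X) := by
    rw [MonObj.mul_eq_mul, MonObj.comp_mul, whiskerLeft_fst, whiskerLeft_snd, comp_translation]
  have h2 : μ[A.X] ≫ A.translation σ = (toUnit _ ≫ σ) * (fst A.X A.X * snd A.X A.X) := by
    rw [comp_translation, ← MonObj.mul_eq_mul]
  rw [h1, h2, mul_left_comm]

/-- **`t_σ` and the inverse of a COMMUTATIVE group scheme**: `t_σ ≫ ι = ι ≫ t_{σ⁻¹}` (`(σx)⁻¹ = σ⁻¹x⁻¹`).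
[cite: MumfordFogartyKirwan1994, Ch. 6 §1 Cor. 6.5 (p. 117)] -/
theorem translation_comp_inv [IsCommMonObj A.X] (σ : A.Sections) :
    A.translation σ ≫ ι[A.X] = ι[A.X] ≫ A.translation σ⁻¹ := by
  have h1 : A.translation σ ≫ ι[A.X] = ((toUnit _ ≫ σ) * 𝟙 A.X)⁻¹ := by
    rw [GrpObj.inv_eq_inv, GrpObj.comp_inv, Category.comp_id]; rfl
  have h2 : ι[A.X] ≫ A.translation σ⁻¹ = (toUnit _ ≫ σ⁻¹) * (𝟙 A.X)⁻¹ := by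
    rw [comp_translation, GrpObj.inv_eq_inv]
  rw [h1, h2, mul_inv, GrpObj.comp_inv]

/-! ## §2 The translation action of a finite subgroup of sections, and its freeness (REAL) -/

section Action

variable {Y : Scheme.{u}} (u : S ⟶ Y) (K : Subgroup A.Sections)

/-- **The translation action of a subgroup `K ⊆ A(S)` on the total space of `A`, over `S → Y`** (the action
datum `ρ : ActionOver r G` of the tree's quotient calculus with `r = (A → S) ≫ u`, `G = K`, `ρ.aut σ = t_σ`; take
`u = 𝟙 S` for `S` affine, or `u : S → Spec k`).  [MumfordAV1970] §7 Thm. 4: the finite subgroup acting by translations.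
[cite: MumfordAV1970, §7 Thm. 4 (p. 72)] -/
def translationActionOver : ActionOver (A.X.hom ≫ u) K where
  aut := ((Over.forget S).mapAut A.X).comp (A.translationAut.comp K.subtype)
  aut_comp σ := by
    change (A.translation (σ : A.Sections)).left ≫ A.X.hom ≫ u = A.X.hom ≫ u
    rw [← Category.assoc, translation_left_comp_hom]

/-- `(ρ.aut σ).hom = (t_σ).left`. [cite: GortzWedhorn2023, Def. 27.1 (p. 604)] -/
@[simp]
theorem translationActionOver_aut_hom (σ : K) :
    ((A.translationActionOver u K).aut σ).hom = (A.translation (σ : A.Sections)).left := rfl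

/-- **Basis-style injectivity on geometric fibres ⇒ no `σ ≠ 1` in `K` fixes a geometric point of the total space**
(the POINTS form of freeness the quotient theorems read — hypothesis `hpt` of ★ `ActionOver.free_of_forall_comp_aut_ne`):
a point `x : Spec Ω → A` over `s̄` with `x ≫ t_σ = x` gives `σ(s̄) · x̄ = x̄` in the group `A_{s̄}(Ω)`, hence `σ(s̄) = e(s̄)`.
(For `K` read through a level structure the hypothesis is the basis clause at `s̄`.)
[cite: SGA1, Exp. V Prop. 2.6 (i), Déf. 2.7] [cite: MumfordFogartyKirwan1994, Ch. 7 §2 Def. 7.1 (p. 129)] -/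
theorem forall_comp_translation_ne_of_forall_restrict_ne
    (h : ∀ (Ω : Type u) [Field Ω] [IsAlgClosed Ω] (s : Spec (.of Ω) ⟶ S) (σ : A.Sections), σ ∈ K → σ ≠ 1 →
      A.restrict s σ ≠ A.restrict s 1) :
    ∀ (Ω : Type u) [Field Ω] [IsAlgClosed Ω] (x : Spec (.of Ω) ⟶ A.left) (σ : K), σ ≠ 1 →
      x ≫ (A.translation (σ : A.Sections)).left ≠ x := by
  intro Ω _ _ x σ hσ hx
  have hσ' : (σ : A.Sections) ≠ 1 := fun h1 => hσ (Subtype.ext h1)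
  let xbar : A.FibrePoints (x ≫ A.X.hom) := Over.homMk x rfl
  have h1 : xbar ≫ A.translation (σ : A.Sections) = xbar := Over.OverMorphism.ext hx
  have h2 : A.restrict (x ≫ A.X.hom) (σ : A.Sections) * xbar = xbar := by
    rw [← comp_translation]; exact h1
  have h3 : A.restrict (x ≫ A.X.hom) (σ : A.Sections) = 1 := mul_eq_right.mp h2
  have h4 : A.restrict (x ≫ A.X.hom) (1 : A.Sections) = 1 := MonObj.comp_one _
  exact h Ω (x ≫ A.X.hom) σ σ.2 hσ' (h3.trans h4.symm)

/-- **Freeness on the affine charts** (ring form: the `t_σ^♯ b − b` generate the unit ideal) from freeness on geometric points,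
for `(A → S → Y)` affine — ★ `ActionOver.free_of_forall_comp_aut_ne`. [cite: SGA1, Exp. V Prop. 2.6 (i), Déf. 2.7] -/
theorem translationActionOver_free [IsAffineHom (A.X.hom ≫ u)]
    (hfree : ∀ (Ω : Type u) [Field Ω] [IsAlgClosed Ω] (x : Spec (.of Ω) ⟶ A.left) (σ : K), σ ≠ 1 →
      x ≫ (A.translation (σ : A.Sections)).left ≠ x) :
    ∀ (U : Y.Opens), IsAffineOpen U → ∀ σ : K, σ ≠ 1 →
      Ideal.span (Set.range fun b : Γ(A.left, (A.X.hom ≫ u) ⁻¹ᵁ U) ↦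
        (A.translationActionOver u K).act σ U b - b) = ⊤ :=
  (A.translationActionOver u K).free_of_forall_comp_aut_ne fun Ω _ _ x σ hσ => hfree Ω x σ hσ

end Action

/-! ## §3 The quotient scheme `A/K` over `S` (REAL, over the tree's glued quotient) -/

section Quotient

variable {Y : Scheme.{u}} (u : S ⟶ Y) (K : Subgroup A.Sections)

/-- `(A → S)` is `K`-invariant: `t_σ.left ≫ (A → S) = (A → S)`. [cite: MumfordAV1970, §7 Thm. 4 (p. 72)] -/
theorem aut_hom_comp_hom (σ : K) : ((A.translationActionOver u K).aut σ).hom ≫ A.X.hom = A.X.hom :=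
  A.translation_left_comp_hom _

variable [Finite K] [Y.IsSeparated] [IsSeparated (A.X.hom ≫ u)] [S.IsSeparated]
  (hcov : ∀ x : A.left, ∃ O : (A.translationActionOver u K).StableAffineOpens, x ∈ O.1)

/-- **The quotient `A/K` as an `S`-scheme**: Mumford's glued quotient ★ `ActionOver.glued` of the total space by the
translation action (the GLUING needs no cover hypothesis; the quotient MAP `quotientMk` below needs a cover of the total
space by `K`-stable affine opens, `hcov` — e.g. `A` quasi-projective over an affine), with structure map the descent ★
`gluedDesc` of the `K`-invariant `A → S`. [cite: MumfordAV1970, §7 Thm. p. 66 and Thm. 4 (p. 72)] -/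
def quotientOver : Over S :=
  Over.mk ((A.translationActionOver u K).gluedDesc A.X.hom (A.aut_hom_comp_hom u K))

/-- The underlying scheme of `A/K` is the glued quotient. [cite: MumfordAV1970, §7 Thm. p. 66] -/
theorem quotientOver_left : (A.quotientOver u K).left = (A.translationActionOver u K).glued := rfl

/-- **The quotient map `ψ : A → A/K` over `S`.** [cite: MumfordAV1970, §7 Thm. 4 (p. 72)] -/
def quotientMk : A.X ⟶ A.quotientOver u K :=
  Over.homMk ((A.translationActionOver u K).gluedMk hcov)
    ((A.translationActionOver u K).gluedMk_gluedDesc hcov A.X.hom (A.aut_hom_comp_hom u K))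

/-- The underlying scheme map of `ψ` is ★ `gluedMk`. [cite: MumfordAV1970, §7 Thm. p. 66] -/
@[simp]
theorem quotientMk_left : (A.quotientMk u K hcov).left = (A.translationActionOver u K).gluedMk hcov := rfl

/-- `ψ` is `K`-invariant: `t_σ ≫ ψ = ψ`. [cite: MumfordAV1970, §7 Thm. 4 (p. 72)] -/
theorem translation_comp_quotientMk (σ : K) :
    A.translation (σ : A.Sections) ≫ A.quotientMk u K hcov = A.quotientMk u K hcov :=
  Over.OverMorphism.ext ((A.translationActionOver u K).aut_hom_gluedMk hcov σ)

/-- `ψ` is surjective. [cite: MumfordAV1970, §7 Thm. p. 66 (1)] -/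
theorem quotientMk_left_surjective : Function.Surjective (A.quotientMk u K hcov).left :=
  (A.translationActionOver u K).gluedMk_surjective hcov

/-- The fibres of `ψ` are the `K`-orbits. [cite: MumfordAV1970, §7 Thm. p. 66 (1)] -/
theorem exists_translation_apply_eq_of_quotientMk_apply_eq {x₁ x₂ : A.left}
    (h : (A.quotientMk u K hcov).left x₁ = (A.quotientMk u K hcov).left x₂) :
    ∃ σ : K, (A.translation (σ : A.Sections)).left x₁ = x₂ :=
  (A.translationActionOver u K).exists_aut_apply_eq_of_gluedMk_eq hcov h

/-- **Over an AFFINE `Y`, `ψ : A → A/K` is a geometric quotient** (Mumford's (1)–(2): affine, `K`-invariant, surjective,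
open, fibres = orbits, `Γ(A/K, W) = Γ(A, ψ⁻¹W)^K`) — ★ `isGeometricQuotient_gluedMk`; with §2's freeness this feeds ★
`IsGeometricQuotient.etale_of_free` / `isFinite_of_free` / `flat_of_free` / `isIso_sigmaDesc_graph_of_free` (torsor) and
the equivariant descent theorems T1/T2/(β). [cite: MumfordAV1970, §7 Thm. p. 66 (1), (2)] -/
theorem isGeometricQuotient_quotientMk [IsAffine Y] :
    (A.translationActionOver u K).IsGeometricQuotient (A.quotientMk u K hcov).left :=
  (A.translationActionOver u K).isGeometricQuotient_gluedMk hcov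

/-- `ψ` is affine (by construction). [cite: MumfordAV1970, §7 Thm. p. 66] -/
theorem isAffineHom_quotientMk_left : IsAffineHom (A.quotientMk u K hcov).left :=
  inferInstanceAs (IsAffineHom ((A.translationActionOver u K).gluedMk hcov))

/-- `ψ` is finite (when `A → S → Y` is locally of finite type). [cite: SGA1, Exp. V Prop. 1.1 and Cor. 1.5] -/
theorem isFinite_quotientMk_left [LocallyOfFiniteType (A.X.hom ≫ u)] : IsFinite (A.quotientMk u K hcov).left :=
  (A.translationActionOver u K).isFinite_gluedMk hcov

/-- **`ψ` is ONTO ON GEOMETRIC FIBRES** (export clause for H3/H4, B-plan1 (g14) 19:38:16Z (1), in B-p04 (g17)'s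
`FibrePoints` shape): every `Ω`-point of `A/K` over a geometric point `s̄` of `S` lifts along `ψ` — `ψ` is surjective and
(finite, hence) locally of finite type, ★ `Morphisms.exists_over_comp_eq_of_surjective`. [cite: MumfordAV1970, §7 Thm. 4 (p. 72)] -/
theorem quotientMk_ontoFibres [LocallyOfFiniteType (A.X.hom ≫ u)] ⦃Ω : Type u⦄ [Field Ω] [IsAlgClosed Ω]
    (s : Spec (.of Ω) ⟶ S) (y : Over.mk s ⟶ A.quotientOver u K) :
    ∃ x : A.FibrePoints s, x ≫ A.quotientMk u K hcov = y :=
  haveI : Surjective (A.quotientMk u K hcov).left := ⟨A.quotientMk_left_surjective u K hcov⟩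
  haveI := A.isFinite_quotientMk_left u K hcov
  Morphisms.exists_over_comp_eq_of_surjective (A.quotientMk u K hcov) s y

include hcov in
/-- **`A/K → S` is separated** (★ `isSeparated_gluedDesc`; export (S2c) for the group-law hand: `IsGeometricQuotient.desc`
needs a separated target). [cite: MumfordAV1970, §7 Thm. p. 66; §12] -/
theorem isSeparated_quotientOver_hom : IsSeparated (A.quotientOver u K).hom :=
  haveI : IsSeparated A.X.hom := IsSeparated.of_comp A.X.hom u
  (A.translationActionOver u K).isSeparated_gluedDesc hcov A.X.hom (A.aut_hom_comp_hom u K)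

include hcov in
/-- The total space of `A/K` is a separated scheme when `S` is. [cite: MumfordAV1970, §7 Thm. p. 66; §12] -/
theorem isSeparated_quotientOver_left : (A.quotientOver u K).left.IsSeparated := by
  haveI := A.isSeparated_quotientOver_hom u K hcov
  refine ⟨?_⟩
  rw [← terminal.comp_from (A.quotientOver u K).hom]
  infer_instance

include hcov in
/-- **`A/K → S` is proper** (★ `isProper_gluedDesc`: separated + universally closed + locally of finite type, from the
proper `A → S`). [cite: SGA1, Exp. V Cor. 1.5] -/
theorem isProper_quotientOver_hom [LocallyOfFiniteType (A.X.hom ≫ u)] [IsLocallyNoetherian Y] :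
    IsProper (A.quotientOver u K).hom :=
  haveI := A.isProper
  (A.translationActionOver u K).isProper_gluedDesc hcov A.X.hom (A.aut_hom_comp_hom u K) u rfl

/-- **The translation action RE-PACKAGED OVER THE QUOTIENT MAP** (export (S2a) for the group-law hand: every ★
free-quotient theorem — `etale_of_free`, `isGeometricQuotient_baseChange_of_free`, (e3) `isPullback_of_equivariant_of_free`,
T1/T2 descent — is stated for `{ρ : ActionOver p G} (hq : ρ.IsGeometricQuotient p)` with the SAME `p`); same `aut` as
`translationActionOver`. [cite: MumfordAV1970, §7 Thm. 4 (p. 72)] -/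
def quotientActionOver : ActionOver (A.quotientMk u K hcov).left K where
  aut := ((Over.forget S).mapAut A.X).comp (A.translationAut.comp K.subtype)
  aut_comp σ := congrArg CommaMorphism.left (A.translation_comp_quotientMk u K hcov σ)

/-- The two action data have the same automorphisms. [cite: MumfordAV1970, §7 Thm. 4 (p. 72)] -/
theorem quotientActionOver_aut : (A.quotientActionOver u K hcov).aut = (A.translationActionOver u K).aut := rfl

/-- `(ρ.aut σ).hom = (t_σ).left` for the re-packaged action. [cite: GortzWedhorn2023, Def. 27.1 (p. 604)] -/
@[simp]
theorem quotientActionOver_aut_hom (σ : K) :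
    ((A.quotientActionOver u K hcov).aut σ).hom = (A.translation (σ : A.Sections)).left := rfl

/-- **Over an AFFINE `Y`, `ψ` is a geometric quotient for the re-packaged action** (same seven clauses as
`isGeometricQuotient_quotientMk`; the `ActionOver` differs only in its base morphism). [cite: MumfordAV1970, §7 Thm. p. 66 (1), (2)] -/
theorem isGeometricQuotient_quotientActionOver [IsAffine Y] :
    (A.quotientActionOver u K hcov).IsGeometricQuotient (A.quotientMk u K hcov).left := by
  obtain ⟨h₁, h₂, h₃, h₄, h₅, h₆, h₇⟩ := A.isGeometricQuotient_quotientMk u K hcov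
  exact ⟨h₁, h₂, h₃, h₄, h₅, h₆, h₇⟩

/-- Freeness of the re-packaged action in the POINTS form the ★ free-quotient theorems convert from (★
`free_of_forall_comp_aut_ne` over the charts of the QUOTIENT, `ψ` affine). [cite: SGA1, Exp. V Prop. 2.6 (i), Déf. 2.7] -/
theorem quotientActionOver_free
    (hfree : ∀ (Ω : Type u) [Field Ω] [IsAlgClosed Ω] (x : Spec (.of Ω) ⟶ A.left) (σ : K), σ ≠ 1 →
      x ≫ (A.translation (σ : A.Sections)).left ≠ x) :
    ∀ (U : (A.quotientOver u K).left.Opens), IsAffineOpen U → ∀ σ : K, σ ≠ 1 →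
      Ideal.span (Set.range fun b : Γ(A.left, (A.quotientMk u K hcov).left ⁻¹ᵁ U) ↦
        (A.quotientActionOver u K hcov).act σ U b - b) = ⊤ :=
  haveI := A.isAffineHom_quotientMk_left u K hcov
  (A.quotientActionOver u K hcov).free_of_forall_comp_aut_ne fun Ω _ _ x σ hσ => hfree Ω x σ hσ

end Quotient

/-! ## §4 The abelian scheme `A/K` (assembly from RAW hypotheses — no sockets, no `Prop`-valued defs; the hypotheses
are DISCHARGED by the follow-up PROOF files: group law `RelativeSpec/GeometricQuotientGroupLaw` (B-p06 (g9)), smoothness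
`Morphisms/SmoothOfFlatSurjectiveSmoothSource` + `AbelianSchemes/AbelianSchemeConstSubgroupQuotientSmooth` (B-p15/B-p09),
geometric connectedness (B-p06)) -/

section GroupLaw

variable {Y : Scheme.{u}} (u : S ⟶ Y) (K : Subgroup A.Sections) [Finite K] [Y.IsSeparated]
  [IsSeparated (A.X.hom ≫ u)] [S.IsSeparated]
  (hcov : ∀ x : A.left, ∃ O : (A.translationActionOver u K).StableAffineOpens, x ∈ O.1)
  [LocallyOfFiniteType (A.X.hom ≫ u)] [IsLocallyNoetherian Y]
  (hG : ∃ _ : GrpObj (A.quotientOver u K), IsMonHom (A.quotientMk u K hcov))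
  (hsm : Smooth (A.quotientOver u K).hom) (hgc : GeometricallyConnected (A.quotientOver u K).hom)

/-- **ASSEMBLY: `A/K` as an abelian scheme over `S`** from (a) an `S`-group-scheme structure on `A/K` making `ψ` a
homomorphism (RAW `∃`-hypothesis `hG`, discharged by `RelativeSpec/GeometricQuotientGroupLaw` for commutative `A`, affine
`Y`, free `K` — [MumfordAV1970] §7 Thm. 4; the law is extracted by choice), (b) smoothness `hsm` and (c) geometric
connectedness `hgc` of `A/K → S` (RAW hypotheses, discharged by the follow-up files), and the REAL properness
`isProper_quotientOver_hom`. [cite: MumfordAV1970, §7 Thm. 4 (p. 72)] -/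
def quotientBy : AbelianSchemeOver S where
  X := A.quotientOver u K
  grpObj := hG.choose
  isProper := A.isProper_quotientOver_hom u K hcov
  isSmooth := hsm
  geometricallyConnected := hgc

/-- The underlying `S`-scheme of `quotientBy` is `quotientOver`. [cite: MumfordAV1970, §7 Thm. 4 (p. 72)] -/
theorem quotientBy_X : (A.quotientBy u K hcov hG hsm hgc).X = A.quotientOver u K := rfl

/-- `ψ : A → A/K` is a homomorphism for the extracted group law. [cite: MumfordAV1970, §7 Thm. 4 (p. 72)] -/
theorem isMonHom_quotientMk :
    letI : GrpObj (A.quotientOver u K) := (A.quotientBy u K hcov hG hsm hgc).grpObj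
    IsMonHom (A.quotientMk u K hcov) :=
  hG.choose_spec

/-- **Export clause «kernel killed» (B-plan1 (g14) 19:38:16Z (1); B-p04 (g17) H3 consumer): for `σ ∈ K`,
`σ ≫ ψ = 1` in `(A/K)(S)`** (as `σ = e ≫ t_σ`, `t_σ ≫ ψ = ψ`, and `ψ` preserves the unit). [cite: MumfordAV1970, §7 Thm. 4 (p. 72)] -/
theorem comp_quotientMk_eq_one (σ : K) :
    letI : GrpObj (A.quotientOver u K) := (A.quotientBy u K hcov hG hsm hgc).grpObj
    (σ : A.Sections) ≫ A.quotientMk u K hcov = (1 : 𝟙_ (Over S) ⟶ A.quotientOver u K) := by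
  letI : GrpObj (A.quotientOver u K) := (A.quotientBy u K hcov hG hsm hgc).grpObj
  haveI := A.isMonHom_quotientMk u K hcov hG hsm hgc
  rw [← A.one_comp_translation (σ : A.Sections), Category.assoc, translation_comp_quotientMk, MonObj.one_comp]

/-- **Export clause «kernel killed by `m`» (B-p04 (g17)'s H3 shape, 19:45:36Z): an `Ω`-point of a fibre of `A`
killed by `ψ` is `m`-torsion, for `K ⊆ A[m](S)`** — the fibres of the FREE geometric quotient `ψ` on `Ω`-points are the
`K`-orbits (★ `IsGeometricQuotient.exists_eq_comp_aut_of_comp_eq_of_free`), so `x = σ(s̄)` for some `σ ∈ K`, and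
`σ ^ m = 1` (over an affine `Y`, freeness in points form). [cite: MumfordAV1970, §7 Thm. 4 (p. 72)] -/
theorem kernelKilledBy_quotientMk [IsAffine Y]
    (hfree : ∀ (Ω : Type u) [Field Ω] [IsAlgClosed Ω] (x : Spec (.of Ω) ⟶ A.left) (σ : K), σ ≠ 1 →
      x ≫ (A.translation (σ : A.Sections)).left ≠ x) {m : ℕ}
    (hK : ∀ σ : K, (σ : A.Sections) ^ m = 1) ⦃Ω : Type u⦄ [Field Ω] [IsAlgClosed Ω] (s : Spec (.of Ω) ⟶ S)
    (x : A.FibrePoints s) :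
    letI : GrpObj (A.quotientOver u K) := (A.quotientBy u K hcov hG hsm hgc).grpObj
    x ≫ A.quotientMk u K hcov = 1 → x ^ m = 1 := by
  letI : GrpObj (A.quotientOver u K) := (A.quotientBy u K hcov hG hsm hgc).grpObj
  haveI := A.isMonHom_quotientMk u K hcov hG hsm hgc
  haveI := A.isAffineHom_quotientMk_left u K hcov
  haveI : Fintype K := Fintype.ofFinite K
  intro hx
  have h1 : (1 : A.FibrePoints s) ≫ A.quotientMk u K hcov = 1 := MonObj.one_comp _
  have h2 : (1 : A.FibrePoints s).left ≫ (A.quotientMk u K hcov).left = x.left ≫ (A.quotientMk u K hcov).left := by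
    rw [← Over.comp_left, ← Over.comp_left, h1, hx]
  obtain ⟨σ, hσ⟩ := (A.isGeometricQuotient_quotientActionOver u K hcov).exists_eq_comp_aut_of_comp_eq_of_free
    (A.quotientActionOver_free u K hcov hfree) _ _ h2
  have h3 : x = (1 : A.FibrePoints s) ≫ A.translation (σ : A.Sections) :=
    Over.OverMorphism.ext (by rw [Over.comp_left]; exact hσ)
  rw [h3, comp_translation, mul_one, ← MonObj.comp_pow, hK σ, MonObj.comp_one]

/-- **Export clause «onto on geometric fibres» in `quotientBy` currency (B-p04 (g17)'s shape 19:45:36Z)**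
(= `quotientMk_ontoFibres`). [cite: MumfordAV1970, §7 Thm. 4 (p. 72)] -/
theorem quotientBy_ontoFibres ⦃Ω : Type u⦄ [Field Ω] [IsAlgClosed Ω] (s : Spec (.of Ω) ⟶ S)
    (y : (A.quotientBy u K hcov hG hsm hgc).FibrePoints s) : ∃ x : A.FibrePoints s, x ≫ A.quotientMk u K hcov = y :=
  A.quotientMk_ontoFibres u K hcov s y

end GroupLaw

end AbelianSchemeOver

end Literature.AlgebraicGeometry.AbelianSchemes

end
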